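import Summits.AtomisticToContinuum.Crystallization.Theorems.OverbindingBudgetAffineCompressedCutA

/-!
# NODE 79 «CompressedCut» (lens-4 g79) — part 2 of 3 (sequel of `…OverbindingBudgetAffineCompressedCutA`)

Split for the 400-line cap by the landing lane (hand-2 g36); the module docstring of part 1 (`…OverbindingBudgetAffineCompressedCutA`) describes the whole node.  Same namespace; all FQNs unchanged.
0 sorry; standard axioms.
-/


namespace Summit.AtomisticToContinuum.Crystallization.Theorems.OverbindingBudgetAffineCompressedCut

open scoped BigOperators Classical
open Literature.MathematicalPhysics.StatisticalMechanics
open Literature.Geometry.DiscreteGeometry (IsChargeFree nearestDist nearestDist_nonneg nearestDist_le_dist)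
open Summit.AtomisticToContinuum.Crystallization.Theorems.OverbindingBudgetMisfitRegistration (Framed Reg DeepReg)
open Summit.AtomisticToContinuum.Crystallization.Theorems.OverbindingBudgetMisfitWindowStatements (InWindow offCount)
open Summit.AtomisticToContinuum.Crystallization.Theorems.OverbindingBudgetBalancedCensusStatements
open Summit.AtomisticToContinuum.Crystallization.Theorems.OverbindingBudgetAffineLadder
open Summit.AtomisticToContinuum.Crystallization.Theorems.OverbindingBudgetAffineLocalisation (pairSum two_mul_interactionEnergy_eq_pairSum
  pairSum_univ_left pairSum_univ_right card_mul_floor_le_half_pairSum)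
open Summit.AtomisticToContinuum.Crystallization.Theorems.OverbindingBudgetAffineMesoCut
open Summit.AtomisticToContinuum.Crystallization.Theorems.OverbindingBudgetAffinePhaseCut
open Summit.AtomisticToContinuum.Crystallization.Theorems.OverbindingBudgetAffineCushionCut
open Summit.AtomisticToContinuum.Crystallization.Theorems.OverbindingBudgetAffineTwinCut
open Summit.AtomisticToContinuum.Crystallization.Theorems.OverbindingBudgetAffineRunCut

variable {N : ℕ}

/-! ## §4b  PROVED: the far-field law `FC` from a two-scale shell sum (`FarFieldControl 12 (1/25)` and `FarFieldControl 24 (1/20)` outright) -/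

/-- **Two-scale shell-sum bound with ratio `λ` and constant `K`**: points pairwise `≥ η` apart and all `≥ ρ ≥ λη` from `p` have
`∑ |p − z|⁻⁶ ≤ K η⁻³ ρ⁻³`.  The Literature gives `(λ, K) = (1, 250)` (`sum_inv_pow_six_le_two_scale`, shells of thickness `ρ`); shells of
thickness `η` give `(30, 21)` below (`sum_inv_pow_six_le_two_scale_sharp`; the volume-count limit is `K → 16` as `λ → ∞`). [this file · kind: packing bound] -/
def TwoScaleShellBound (lam K : ℝ) : Prop :=
  ∀ (t : Finset (EuclideanSpace ℝ (Fin 3))) (p : EuclideanSpace ℝ (Fin 3)) (η ρ : ℝ), 0 < η → lam * η ≤ ρ →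
    (∀ z ∈ t, ∀ w ∈ t, z ≠ w → η ≤ dist z w) → (∀ z ∈ t, ρ ≤ dist p z) →
      ∑ z ∈ t, (dist p z)⁻¹ ^ 6 ≤ K * η⁻¹ ^ 3 * ρ⁻¹ ^ 3

/-- The Literature two-scale shell sum: `TwoScaleShellBound 1 250`. [Literature `sum_inv_pow_six_le_two_scale`] -/
theorem twoScaleShellBound_250 : TwoScaleShellBound 1 250 :=
  fun t p _ _ hη hηρ ht hp => sum_inv_pow_six_le_two_scale t p hη (by rw [one_mul] at hηρ; exact hηρ) ht hp

/-- `(x+1)⁻⁴ ≤ 1/(3x³) − 1/(3(x+1)³)` for `x ≥ 1` (telescoping majorant of `b⁻⁴`). [this file] -/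
theorem inv_pow_four_le_sub {x : ℝ} (hx : 1 ≤ x) :
    ((x + 1)⁻¹) ^ 4 ≤ 1 / (3 * x ^ 3) - 1 / (3 * (x + 1) ^ 3) := by
  have hx0 : 0 < x := by linarith
  have hx1 : 0 < x + 1 := by linarith
  rw [inv_pow, ← one_div, le_sub_iff_add_le, div_add_div _ _ (by positivity) (by positivity),
    div_le_div_iff₀ (by positivity) (by positivity)]
  nlinarith [mul_nonneg (pow_nonneg hx1.le 3) (show (0:ℝ) ≤ 6 * x ^ 2 + 4 * x + 1 by positivity),
    pow_pos hx0 3, pow_pos hx1 4]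

/-- `∑_{b = b₀}^{M} b⁻⁴ ≤ 1/(3 (b₀ − 1)³)` for `b₀ ≥ 2`. [this file] -/
theorem sum_Icc_inv_pow_four_le {b₀ : ℕ} (hb₀ : 2 ≤ b₀) (M : ℕ) :
    ∑ b ∈ Finset.Icc b₀ M, ((b : ℝ))⁻¹ ^ 4 ≤ 1 / (3 * ((b₀ : ℝ) - 1) ^ 3) := by
  have key : ∀ n : ℕ, b₀ - 1 ≤ n →
      ∑ b ∈ Finset.Icc b₀ n, ((b : ℝ))⁻¹ ^ 4 ≤ 1 / (3 * ((b₀ : ℝ) - 1) ^ 3) - 1 / (3 * (n : ℝ) ^ 3) := by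
    intro n hn
    induction n, hn using Nat.le_induction with
    | base =>
      have h0 : Finset.Icc b₀ (b₀ - 1) = ∅ := Finset.Icc_eq_empty (by omega)
      have hc : ((b₀ - 1 : ℕ) : ℝ) = (b₀ : ℝ) - 1 := by
        rw [Nat.cast_sub (by omega)]; simp
      rw [h0, Finset.sum_empty, hc]
      linarith
    | succ n hn ih =>
      rw [Finset.sum_Icc_succ_top (by omega : b₀ ≤ n + 1)]
      have hn1 : (1 : ℝ) ≤ (n : ℝ) := by exact_mod_cast (show 1 ≤ n by omega)
      have h := inv_pow_four_le_sub hn1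
      push_cast
      linarith
  have hB : (0 : ℝ) < (b₀ : ℝ) - 1 := by
    have : (2 : ℝ) ≤ b₀ := by exact_mod_cast hb₀
    linarith
  rcases lt_or_ge M b₀ with hM | hM
  · rw [Finset.Icc_eq_empty (by omega), Finset.sum_empty]
    positivity
  · have h := key M (by omega)
    have hM0 : (0 : ℝ) ≤ 1 / (3 * (M : ℝ) ^ 3) := by positivity
    linarith

/-- **Sharp two-scale shell sum** (`TwoScaleShellBound 30 21`).  Points pairwise `≥ η` apart and all `≥ ρ ≥ 30η` from `p`:
`∑ |p − z|⁻⁶ ≤ 21 η⁻³ ρ⁻³` — the shells `bη ≤ |p − z| < (b+1)η`, `b ≥ b₀ = ⌊ρ/η⌋ ≥ 30`, hold `≤ (2b+3)³ − (2b−1)³ = 48b² + 48b + 28 ≤ 50 b²`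
points each (`card_le_of_separated_of_mem_shell`), every term is `≤ (bη)⁻⁶`, and `∑_{b ≥ b₀} b⁻⁴ ≤ 1/(3(b₀ − 1)³) ≤ (15/14)³/3 · (η/ρ)³`;
`50·(15/14)³/3 = 20.5 ≤ 21`. [this file · folklore volume packing] -/
theorem sum_inv_pow_six_le_two_scale_sharp (t : Finset (EuclideanSpace ℝ (Fin 3))) (p : EuclideanSpace ℝ (Fin 3))
    {η ρ : ℝ} (hη : 0 < η) (hρ : 30 * η ≤ ρ)
    (ht : ∀ z ∈ t, ∀ w ∈ t, z ≠ w → η ≤ dist z w) (hp : ∀ z ∈ t, ρ ≤ dist p z) :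
    ∑ z ∈ t, (dist p z)⁻¹ ^ 6 ≤ 21 * η⁻¹ ^ 3 * ρ⁻¹ ^ 3 := by
  classical
  have hρpos : 0 < ρ := by nlinarith
  have hq : (30 : ℝ) ≤ ρ / η := by rw [le_div_iff₀ hη]; linarith
  set m : EuclideanSpace ℝ (Fin 3) → ℕ := fun z => ⌊dist p z / η⌋₊ with hm
  set u := t.image m with hu_def
  set b₀ : ℕ := ⌊ρ / η⌋₊ with hb₀
  have hb₀30 : 30 ≤ b₀ := Nat.le_floor (by exact_mod_cast hq)
  have hb₀gt : ρ / η < (b₀ : ℝ) + 1 := Nat.lt_floor_add_one _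
  have hmem : ∀ z ∈ t, m z ∈ u := fun z hz => Finset.mem_image_of_mem m hz
  have hmb : ∀ z ∈ t, b₀ ≤ m z := fun z hz =>
    Nat.floor_mono (div_le_div_of_nonneg_right (hp z hz) hη.le)
  have hm1 : ∀ z ∈ t, 1 ≤ m z := fun z hz => le_trans (by omega) (hmb z hz)
  have hmle : ∀ z ∈ t, η * m z ≤ dist p z := fun z hz => by
    have := Nat.floor_le (div_nonneg dist_nonneg hη.le : 0 ≤ dist p z / η)
    rwa [le_div_iff₀ hη, mul_comm] at this
  have hmlt : ∀ z ∈ t, dist p z < (m z + 1) * η := fun z hz => by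
    have := Nat.lt_floor_add_one (dist p z / η)
    rwa [div_lt_iff₀ hη] at this
  have hub : ∀ b ∈ u, b₀ ≤ b := fun b hb => by
    obtain ⟨z, hz, rfl⟩ := Finset.mem_image.1 hb; exact hmb z hz
  -- (1) termwise `|p − z|⁻⁶ ≤ (η m_z)⁻⁶`
  have step1 : ∑ z ∈ t, (dist p z)⁻¹ ^ 6 ≤ ∑ z ∈ t, η⁻¹ ^ 6 * ((m z : ℝ))⁻¹ ^ 6 := by
    refine Finset.sum_le_sum fun z hz => ?_
    rw [← mul_pow, ← mul_inv]
    have h0 : 0 < η * m z := mul_pos hη (by exact_mod_cast hm1 z hz)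
    exact pow_le_pow_left₀ (inv_nonneg.2 dist_nonneg) (inv_anti₀ h0 (hmle z hz)) _
  -- (2) regroup by shells of thickness `η`
  have step2 : ∑ z ∈ t, η⁻¹ ^ 6 * ((m z : ℝ))⁻¹ ^ 6 =
      ∑ b ∈ u, ((t.filter fun z => m z = b).card : ℝ) * (η⁻¹ ^ 6 * ((b : ℝ))⁻¹ ^ 6) := by
    have := Finset.sum_fiberwise_of_maps_to' hmem (fun b : ℕ => η⁻¹ ^ 6 * ((b : ℝ))⁻¹ ^ 6)
    simp only [Finset.sum_const, nsmul_eq_mul] at this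
    exact this.symm
  -- (3) each shell holds at most `(2b+3)³ − (2b−1)³ = 48b² + 48b + 28` points
  have step3 : ∀ b ∈ u, ((t.filter fun z => m z = b).card : ℝ) ≤ 48 * (b : ℝ) ^ 2 + 48 * b + 28 := by
    intro b hb
    have hb1 : (1 : ℝ) ≤ b := by exact_mod_cast le_trans (by omega) (hb₀30.trans (hub b hb))
    set F := t.filter fun z => m z = b with hF
    have hR₂ : (0 : ℝ) ≤ ((b : ℝ) + 1) * η := by positivity
    have hR : (b : ℝ) * η ≤ ((b : ℝ) + 1) * η := by nlinarith
    have hcard := card_le_of_separated_of_mem_shell F p hη hR₂ hR ?_ ?_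
    · rw [finrank_euclideanSpace_fin] at hcard
      have e1 : 2 * (((b : ℝ) + 1) * η) / η + 1 = 2 * b + 3 := by field_simp; ring
      have e2 : 2 * ((b : ℝ) * η) / η - 1 = 2 * b - 1 := by field_simp
      have e3 : (2 * (b : ℝ) + 3) ^ 3 - (2 * b - 1) ^ 3 = 48 * (b : ℝ) ^ 2 + 48 * b + 28 := by ring
      rw [e1, e2, max_eq_left (by linarith)] at hcard
      linarith
    · intro c hc
      obtain ⟨hct, hcb⟩ := Finset.mem_filter.1 hc
      rw [dist_comm]
      have h1 := hmle c hct
      have h2 := hmlt c hct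
      rw [hcb] at h1 h2
      constructor <;> linarith
    · intro c hc c' hc' hne
      exact ht c (Finset.mem_filter.1 hc).1 c' (Finset.mem_filter.1 hc').1 hne
  -- (4) numerics per shell: `(48b² + 48b + 28) b⁻⁶ ≤ 50 b⁻⁴` for `b ≥ 30`
  have step4 : ∀ b ∈ u, (48 * (b : ℝ) ^ 2 + 48 * b + 28) * (η⁻¹ ^ 6 * ((b : ℝ))⁻¹ ^ 6) ≤
      50 * η⁻¹ ^ 6 * ((b : ℝ))⁻¹ ^ 4 := by
    intro b hb
    have hb30 : (30 : ℝ) ≤ b := by exact_mod_cast (hb₀30.trans (hub b hb))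
    have hbpos : (0 : ℝ) < b := by linarith
    set v : ℝ := ((b : ℝ))⁻¹ with hv_def
    have hv0 : 0 ≤ v := by positivity
    have hv : v ≤ 30⁻¹ := inv_anti₀ (by norm_num) hb30
    have hbv : (b : ℝ) * v = 1 := mul_inv_cancel₀ hbpos.ne'
    have e : (48 * (b : ℝ) ^ 2 + 48 * b + 28) * v ^ 6 = (48 + 48 * v + 28 * v ^ 2) * v ^ 4 := by
      linear_combination (48 * v ^ 4 * ((b : ℝ) * v + 1) + 48 * v ^ 5) * hbv
    have hpoly : 48 + 48 * v + 28 * v ^ 2 ≤ 50 := by nlinarith [mul_le_mul hv hv hv0 (by norm_num)]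
    have hη6 : 0 ≤ η⁻¹ ^ 6 := by positivity
    calc (48 * (b : ℝ) ^ 2 + 48 * b + 28) * (η⁻¹ ^ 6 * v ^ 6)
        = η⁻¹ ^ 6 * ((48 + 48 * v + 28 * v ^ 2) * v ^ 4) := by rw [← e]; ring
      _ ≤ η⁻¹ ^ 6 * (50 * v ^ 4) :=
          mul_le_mul_of_nonneg_left (mul_le_mul_of_nonneg_right hpoly (by positivity)) hη6
      _ = 50 * η⁻¹ ^ 6 * v ^ 4 := by ring
  -- (5) the tail `∑_{b ∈ u} b⁻⁴ ≤ 1/(3 (b₀ − 1)³)`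
  have step5 : ∑ b ∈ u, ((b : ℝ))⁻¹ ^ 4 ≤ 1 / (3 * ((b₀ : ℝ) - 1) ^ 3) := by
    have hsub : u ⊆ Finset.Icc b₀ (u.sup id) := fun b hb => by
      rw [Finset.mem_Icc]; exact ⟨hub b hb, Finset.le_sup (f := id) hb⟩
    calc ∑ b ∈ u, ((b : ℝ))⁻¹ ^ 4 ≤ ∑ b ∈ Finset.Icc b₀ (u.sup id), ((b : ℝ))⁻¹ ^ 4 :=
          Finset.sum_le_sum_of_subset_of_nonneg hsub fun b _ _ => by positivity
      _ ≤ _ := sum_Icc_inv_pow_four_le (by omega) _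
  -- (6) `50 η⁻⁶ / (3 (b₀ − 1)³) ≤ 21 η⁻³ ρ⁻³` since `b₀ − 1 ≥ ρ/η − 2 ≥ (14/15) ρ/η`
  set B : ℝ := (b₀ : ℝ) - 1 with hB_def
  have hB : 14 / 15 * (ρ / η) ≤ B := by rw [hB_def]; linarith
  have hBpos : 0 < B := by
    have : (0 : ℝ) < ρ / η := by positivity
    linarith
  have hBη : 14 / 15 * ρ ≤ B * η := by
    have := mul_le_mul_of_nonneg_right hB hη.le
    rwa [mul_assoc, div_mul_cancel₀ _ hη.ne'] at this
  have hcube : (14 / 15 * ρ) ^ 3 ≤ (B * η) ^ 3 := pow_le_pow_left₀ (by positivity) hBη 3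
  have hX : ((B * η) ^ 3)⁻¹ ≤ ((14 / 15 * ρ) ^ 3)⁻¹ := inv_anti₀ (by positivity) hcube
  have e6 : 50 * η⁻¹ ^ 6 * (1 / (3 * B ^ 3)) = 50 / 3 * η⁻¹ ^ 3 * ((B * η) ^ 3)⁻¹ := by
    field_simp
  have e7 : ((14 / 15 * ρ) ^ 3)⁻¹ = 3375 / 2744 * ρ⁻¹ ^ 3 := by
    field_simp; norm_num
  have step6 : 50 * η⁻¹ ^ 6 * (1 / (3 * B ^ 3)) ≤ 21 * η⁻¹ ^ 3 * ρ⁻¹ ^ 3 := by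
    rw [e6]
    have hη3 : 0 ≤ 50 / 3 * η⁻¹ ^ 3 := by positivity
    have hpos : 0 ≤ η⁻¹ ^ 3 * ρ⁻¹ ^ 3 := by positivity
    calc 50 / 3 * η⁻¹ ^ 3 * ((B * η) ^ 3)⁻¹ ≤ 50 / 3 * η⁻¹ ^ 3 * ((14 / 15 * ρ) ^ 3)⁻¹ :=
          mul_le_mul_of_nonneg_left hX hη3
      _ = 50 / 3 * (3375 / 2744) * (η⁻¹ ^ 3 * ρ⁻¹ ^ 3) := by rw [e7]; ring
      _ ≤ 21 * η⁻¹ ^ 3 * ρ⁻¹ ^ 3 := by nlinarith [hpos]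
  -- assemble
  calc ∑ z ∈ t, (dist p z)⁻¹ ^ 6
      ≤ ∑ b ∈ u, ((t.filter fun z => m z = b).card : ℝ) * (η⁻¹ ^ 6 * ((b : ℝ))⁻¹ ^ 6) :=
        step1.trans_eq step2
    _ ≤ ∑ b ∈ u, (48 * (b : ℝ) ^ 2 + 48 * b + 28) * (η⁻¹ ^ 6 * ((b : ℝ))⁻¹ ^ 6) :=
        Finset.sum_le_sum fun b hb => mul_le_mul_of_nonneg_right (step3 b hb) (by positivity)
    _ ≤ ∑ b ∈ u, 50 * η⁻¹ ^ 6 * ((b : ℝ))⁻¹ ^ 4 := Finset.sum_le_sum step4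
    _ = 50 * η⁻¹ ^ 6 * ∑ b ∈ u, ((b : ℝ))⁻¹ ^ 4 := by rw [Finset.mul_sum]
    _ ≤ 50 * η⁻¹ ^ 6 * (1 / (3 * B ^ 3)) := mul_le_mul_of_nonneg_left step5 (by positivity)
    _ ≤ 21 * η⁻¹ ^ 3 * ρ⁻¹ ^ 3 := step6

/-- The sharp two-scale shell sum as `TwoScaleShellBound 30 21`. [this file] -/
theorem twoScaleShellBound_21 : TwoScaleShellBound 30 21 :=
  fun t p _ _ hη hηρ ht hp => sum_inv_pow_six_le_two_scale_sharp t p hη hηρ ht hp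

/-- A weighted pair with weight in `[0, 1]` costs at most the attractive tail: `−d⁻⁶/6 ≤ w·V(d)`. [this file] -/
theorem neg_le_mul_lennardJones {w t : ℝ} (hw0 : 0 ≤ w) (hw1 : w ≤ 1) (ht : 0 < t) :
    -(1 / 6 * (t⁻¹) ^ 6) ≤ w * lennardJones t := by
  have hV := neg_le_lennardJones_of_le ht le_rfl
  have h6 : 0 ≤ 1 / 6 * (t⁻¹) ^ 6 := by positivity
  nlinarith [mul_le_mul_of_nonneg_left hV hw0, mul_nonneg (sub_nonneg.2 hw1) h6]

/-- **`FC` from a two-scale shell sum.**  At a priced site `i` (scale `s = nn_i`), every far site that pulls with non-zero weight has own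
spacing `> (2/5)·s`: a priced one by the weight rule, a sound unpriced one because `nn ≥ s₀ ≥ (2/5)·s₁ > (2/5)·s`, and a bad one enters through
`max V 0 ≥ 0`.  The pullers are therefore pairwise `≥ (2/5)s` apart and `≥ R s` away, and `V ≥ −d⁻⁶/6`; a bound `K` gives
`farLoad ≥ −(125 K / 48) R⁻³ s⁻⁶` once `R ≥ (2/5)λ`. [this file] -/
theorem farFieldControlAt_of_twoScale {lam K ρ ρ₁ η θ₀ s₀ s₁ ε g δ R κ : ℝ} (hK : TwoScaleShellBound lam K) (hlam : 0 < lam)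
    (hδ : 0 < δ) (hs : 2 * s₁ ≤ 5 * s₀) (hR : 2 / 5 * lam ≤ R) (hκ : 125 * K ≤ 48 * κ * R ^ 3) :
    FarFieldControlAt ρ ρ₁ η θ₀ s₀ s₁ ε g δ R κ := by
  intro N y hy i hi
  unfold farLoad
  have hnn : 0 < nearestDist y i := nearestDist_pos_of_priced hδ hi
  have h25 : 2 / 5 * nearestDist y i < s₀ := by
    rcases hi.2 with h | ⟨_, h⟩ <;> linarith
  set s := nearestDist y i with hs_def
  have hRpos : 0 < R := lt_of_lt_of_le (by positivity) hR
  have hRs : 0 < R * s := mul_pos hRpos hnn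
  set F₁ := Finset.univ.filter (fun k => Priced ρ ρ₁ η θ₀ s₀ s₁ ε g δ y k ∧ ¬ dist (y i) (y k) ≤ R * s) with hF₁
  set F₂ := Finset.univ.filter
    (fun k => (Sound ρ ε g δ y k ∧ ¬ Priced ρ ρ₁ η θ₀ s₀ s₁ ε g δ y k) ∧ ¬ dist (y i) (y k) ≤ R * s) with hF₂
  set F₃ := Finset.univ.filter (fun k => ¬ Sound ρ ε g δ y k ∧ ¬ dist (y i) (y k) ≤ R * s) with hF₃
  set T := Finset.univ.filter (fun k => ¬ dist (y i) (y k) ≤ R * s ∧ 2 / 5 * s < nearestDist y k) with hT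
  have hdpos : ∀ k, ¬ dist (y i) (y k) ≤ R * s → 0 < dist (y i) (y k) := fun k hk => hRs.trans (not_le.1 hk)
  -- (1) the two-scale shell sum over the puller class `T`
  have hTsum : ∑ k ∈ T, (dist (y i) (y k))⁻¹ ^ 6 ≤ K * (2 / 5 * s)⁻¹ ^ 3 * (R * s)⁻¹ ^ 3 := by
    have himg : ∑ z ∈ T.image y, (dist (y i) z)⁻¹ ^ 6 = ∑ k ∈ T, (dist (y i) (y k))⁻¹ ^ 6 :=
      Finset.sum_image fun k _ l _ h => hy h
    rw [← himg]
    refine hK (T.image y) (y i) (2 / 5 * s) (R * s) (by positivity) (by nlinarith) ?_ ?_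
    · intro z hz w hw hzw
      obtain ⟨k, hk, rfl⟩ := Finset.mem_image.1 hz
      obtain ⟨l, hl, rfl⟩ := Finset.mem_image.1 hw
      have hkl : k ≠ l := fun h => hzw (by rw [h])
      exact ((Finset.mem_filter.1 hk).2.2).le.trans (nearestDist_le_dist y hkl.symm)
    · intro z hz
      obtain ⟨k, hk, rfl⟩ := Finset.mem_image.1 hz
      exact (not_le.1 (Finset.mem_filter.1 hk).2.1).le
  -- (2) termwise lower bounds for the three far sums
  have h1 : ∀ k ∈ F₁, -(if 2 / 5 * s < nearestDist y k then 1 / 6 * (dist (y i) (y k))⁻¹ ^ 6 else 0)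
      ≤ scaleWeight y i k * lennardJones (dist (y i) (y k)) := by
    intro k hk
    have hk' := (Finset.mem_filter.1 hk).2
    split_ifs with hlt
    · exact neg_le_mul_lennardJones (scaleWeight_nonneg y i k) (scaleWeight_le_one y i k) (hdpos k hk'.2)
    · have hw : scaleWeight y i k = 0 := by
        unfold scaleWeight
        rw [if_pos (not_lt.1 hlt)]
      rw [hw, zero_mul, neg_zero]
  have h2 : ∀ k ∈ F₂, -(1 / 6 * (dist (y i) (y k))⁻¹ ^ 6) ≤ lennardJones (dist (y i) (y k)) :=
    fun k hk => neg_le_lennardJones_of_le (hdpos k (Finset.mem_filter.1 hk).2.2) le_rfl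
  have h3 : 0 ≤ ∑ k ∈ F₃, max (lennardJones (dist (y i) (y k))) 0 :=
    Finset.sum_nonneg fun k _ => le_max_right _ _
  -- (3) the summed bounds
  have e1 : ∑ k ∈ F₁, (if 2 / 5 * s < nearestDist y k then 1 / 6 * (dist (y i) (y k))⁻¹ ^ 6 else 0) =
      1 / 6 * ∑ k ∈ F₁.filter (fun k => 2 / 5 * s < nearestDist y k), (dist (y i) (y k))⁻¹ ^ 6 := by
    rw [Finset.mul_sum]
    exact (Finset.sum_filter (s := F₁) _ _).symm
  have hS1 : -(1 / 6 * ∑ k ∈ F₁.filter (fun k => 2 / 5 * s < nearestDist y k), (dist (y i) (y k))⁻¹ ^ 6) ≤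
      ∑ k ∈ F₁, scaleWeight y i k * lennardJones (dist (y i) (y k)) := by
    have := Finset.sum_le_sum h1
    rwa [Finset.sum_neg_distrib, e1] at this
  have hS2 : -(1 / 6 * ∑ k ∈ F₂, (dist (y i) (y k))⁻¹ ^ 6) ≤ ∑ k ∈ F₂, lennardJones (dist (y i) (y k)) := by
    have := Finset.sum_le_sum h2
    rwa [Finset.sum_neg_distrib, ← Finset.mul_sum] at this
  -- (4) both index sums are pieces of the `T`-sum
  have hdisj : Disjoint (F₁.filter (fun k => 2 / 5 * s < nearestDist y k)) F₂ :=
    Finset.disjoint_left.2 fun k hk hk' =>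
      (Finset.mem_filter.1 hk').2.1.2 (Finset.mem_filter.1 (Finset.mem_filter.1 hk).1).2.1
  have hsub : F₁.filter (fun k => 2 / 5 * s < nearestDist y k) ∪ F₂ ⊆ T := by
    refine Finset.union_subset (fun k hk => ?_) (fun k hk => ?_)
    · have hk1 := Finset.mem_filter.1 hk
      have hk0 := (Finset.mem_filter.1 hk1.1).2
      exact Finset.mem_filter.2 ⟨Finset.mem_univ _, hk0.2, hk1.2⟩
    · have hk0 := (Finset.mem_filter.1 hk).2
      have hnP : s₀ ≤ nearestDist y k := not_lt.1 fun h => hk0.1.2 ⟨hk0.1.1, Or.inl h⟩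
      exact Finset.mem_filter.2 ⟨Finset.mem_univ _, hk0.2, h25.trans_le hnP⟩
  have h12 : ∑ k ∈ F₁.filter (fun k => 2 / 5 * s < nearestDist y k), (dist (y i) (y k))⁻¹ ^ 6 +
      ∑ k ∈ F₂, (dist (y i) (y k))⁻¹ ^ 6 ≤ ∑ k ∈ T, (dist (y i) (y k))⁻¹ ^ 6 := by
    rw [← Finset.sum_union hdisj]
    exact Finset.sum_le_sum_of_subset_of_nonneg hsub fun k _ _ => by positivity
  -- (5) arithmetic: `K (2s/5)⁻³ (Rs)⁻³ / 6 ≤ κ s⁻⁶`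
  have hs0 : s ≠ 0 := hnn.ne'
  have hR0 : R ≠ 0 := hRpos.ne'
  have hA : K * (2 / 5 * s)⁻¹ ^ 3 * (R * s)⁻¹ ^ 3 = 125 / 8 * K * (R ^ 3)⁻¹ * s⁻¹ ^ 6 := by
    field_simp
    ring
  have hR3 : (0 : ℝ) < R ^ 3 := by positivity
  have hκ' : 1 / 6 * (125 / 8 * K * (R ^ 3)⁻¹) ≤ κ := by
    rw [show 1 / 6 * (125 / 8 * K * (R ^ 3)⁻¹) = 125 * K / 48 * (R ^ 3)⁻¹ by ring, mul_inv_le_iff₀ hR3]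
    nlinarith
  have hu : 0 ≤ s⁻¹ ^ 6 := by positivity
  have hfin := mul_le_mul_of_nonneg_right hκ' hu
  rw [hA] at hTsum
  nlinarith [hS1, hS2, h3, h12, hTsum, hfin]

/-- `FC R κ` on all windows from a two-scale bound `(λ, K)` with `R ≥ (2/5)λ` and `125 K ≤ 48 κ R³` (node parameters `s₀ = 1/2`, `s₁ = 17/20`).
[this file] -/
theorem farFieldControl_of_twoScale {lam K R κ : ℝ} (hK : TwoScaleShellBound lam K) (hlam : 0 < lam) (hR : 2 / 5 * lam ≤ R)
    (hκ : 125 * K ≤ 48 * κ * R ^ 3) : FarFieldControl R κ :=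
  fun δ hδ _ => farFieldControlAt_of_twoScale hK hlam hδ (by norm_num) hR hκ

/-- **`FarFieldControl 24 (1/20)` — PROVED** (Literature constant `(1, 250)`: `125·250 = 31250 ≤ 48·(1/20)·24³ = 33177.6`). [this file] -/
theorem farFieldControl_24 : FarFieldControl 24 (1 / 20) :=
  farFieldControl_of_twoScale twoScaleShellBound_250 (by norm_num) (by norm_num) (by norm_num)

/-- **`FarFieldControl 12 (1/25)` — PROVED** (sharp constant `(30, 21)`: `(2/5)·30 = 12`, `125·21 = 2625 ≤ 48·(1/25)·12³ = 3317.76`). [this file] -/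
theorem farFieldControl_12 : FarFieldControl 12 (1 / 25) :=
  farFieldControl_of_twoScale twoScaleShellBound_21 (by norm_num) (by norm_num) (by norm_num)

end Summit.AtomisticToContinuum.Crystallization.Theorems.OverbindingBudgetAffineCompressedCut
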